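import Summits.ValiantsHypothesis.ValiantsHypothesis.Theorems.GrenetZeonDualUnipotentThreeHalvesSlowCoreLedger
import Summits.ValiantsHypothesis.ValiantsHypothesis.Theorems.GrenetZeonDualUnipotentThreeHalvesSlowCoreCoarsen
import Summits.ValiantsHypothesis.ValiantsHypothesis.Theorems.GrenetZeonDualUnipotentThreeHalvesLongMassResolventFlag

/-!
# `GrenetZeon.DualUnipotentThreeHalves` (stmt-ValiantsHypothesis-24318) — line of record `Lines/slow_core.lean` rev 4,
# stub `stub_longMassSlowLawInv` ((c) `SlowCore.LongMassSlowLawInv`): the **RANK ROW** (candidate r12 of the crit-7 V27/V41 menu)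

val-idea-29 g8 (planner · ideation lens «REFUTE: hunt a counter-instance (m,n) with the cell val-heavytop-census»; crux WORKFILE,
kit 0, no claim, no card — lineage budget 3/3 used).  REV 1.1: name nit of crit-7 g4 V48 fixed (✓ `SlowCore.ledger_top_of_conj`).  Companion memo: `MEMO-idea29-g8-rank-row.md` (same directory).

**REV 2 (val-idea-29 g9, 2026-08-29): (G7b) DONE — `theorem rankRow_holds : RankRow` is PROVED in §3 below (0 sorry; axioms `propext`,
`Classical.choice`, `Quot.sound`; imports Theorems only).**  REV 2.1: + `theorem rankRowConst_holds : RankRowConst` (§F′, same axioms).  §3 is self-contained engineering over `ℂ[s]`, `ℂ[s][u]`, `K[t]`: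
§P the `s`-pencil and pointwise ⇒ polynomial nilpotency (`MvPolynomial.funext`); §A flag-banded ("admissible") matrices over `ℂ[s]`
(the r2 gap count: weight-`j` products carry `s^e` only at `π`-gap `≥ j + e·q`, so `deg_s ≤ ⌊(b-1)/(q+1)⌋` and `A'^b = 0`); §B uniform
`s`-degree of `u`-coefficients (`DegLE`, closed under `+ Σ * u•`); §C **transfer nilpotency over a GENERIC commutative ring `K`**
(`isNilpotent_transfer`: `A^b = 0 ∧ (A + tS)^b = 0` in `M_b(K[t])` ⇒ `G = R_A(u)·uS` nilpotent — by the factorisation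
`1 - u(A + tS) = (1 - uA)(1 - tG)`, the two geometric inverses, and the `t`-coefficient recursion `coeff_t^k ((1 - tG)⁻¹) = G^k`
against a `t`-degree bound; no determinants), fed by §P twice (`pencilT_pow_eq_zero`: the `t`-polynomial identity from its complex
roots `t₀ ∈ ℂ ⊂ ℂ[s][u]`, `Polynomial.eq_zero_of_infinite_isRoot`); §D rank reduction (`S₀ = P·Q₀` through `ℂ^{rank S₀}` by
`Module.finBasis` of the column space; `(EF)^{c+1} = E (FE)^c F` and ✓ `SlowCore.pow_card_eq_zero_of_pow_eq_zero` over the domain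
`ℂ[s][u]`) ⇒ `G^{r+1} = 0`; §E extraction = §1 `resolvent_add_of_transfer_pow_eq_zero` + the `u^p`-coefficient comparison of
✓ `ResolventFlag.totalDegree_pow_apply_le_of_twist_pow_eq_zero` ⇒ `deg_s (M^p)_{ij} ≤ (r+2)·κ`; §F the direction space
`K = lin⁻¹(T₀) ⊓ freezeSpace(small π-gaps)` (codim `≤ σ + b q`: rank–nullity through `T₀.mkQ ∘ lin` whose range lies in `mkQ(S)`,
✓ `SlowCore.codim_freezeSpace_le`, and `#{0 < π i' - π i ≤ q} ≤ b q` by an injection into `Fin b × range q`) and the assembly.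
Design note: the `t`-recursion is stated over an opaque `K` because `rw` with generic ring lemmas does not fire on matrices over the
depth-3 tower `ℂ[s][u][t]` (instance-path mismatch); instantiating `K := ℂ[s][u]` afterwards is free.  `RankRowConst` (general
constant flag) follows in §F′ (`rankRowConst_holds`: conjugate, `rankRow_holds` with `π = 1`, return by ✓ `SlowCore.ledger_top_of_conj`).
HONEST FRAMING unchanged: a calibration row (crit-7 V49: r12 is calibration), now a THEOREM; (c) / 24318 OPEN; `VP ≠ VNP` NOT proved.

## What this file certifies (0 sorry)

§1 **Woodbury with a nilpotent capacitance**, abstract ring form (both sides):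
   `(M - S) * (R' + R' * S * N * R') = 1` from `M * R' = 1` and `(1 - R' * S) * N = 1`, and the mirror identity; and the
   capacitance `N = ∑_{i<r} G^i` from `G ^ r = 0` (`woodburyCap_mul`, `mul_woodburyCap`).  These are the two algebraic facts
   behind the rank row: in the memo `M = 1 - u·A'` (`A'` strictly upper triangular in a CONSTANT flag, a polynomial in the line
   parameter `s` only through letters of flag-gap `> q`), `S = u·S₀` (the skew part of the BASE POINT, a constant in `s`, of rank `≤ r`),
   `R' = ∑_j u^j A'^j` (so `deg_s` of every `u`-coefficient of `R'` is `≤ κ := ⌊(b-1)/(q+1)⌋`, the r2 gap count), and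
   `G = R' * S` is NILPOTENT because the closed value cone `W̄ = T₀ ⊕ S` is a nil space (`A' + t·S₀ ∈ W̄ ⊗ ℂ[s,t]`, Sylvester:
   `det (1 - t·G) = det (1 - u(A' + t S₀)) / det (1 - u A') = 1`) and has rank `≤ r`, whence `G ^ (r+1) = 0`.  Consequently
   `∑_p u^p (B(x + s v))^p = (M - S)⁻¹ = R' + R' S N R'` has `deg_s ≤ (r+2)·κ` in every `u`-coefficient: a LEDGER.

§2 **The row as a typed provider signature** `RankRow` in ✓ `SlowCore.RelCert` currency (a `def … : Prop`; PROVED in §3 as of rev 2 — the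
   `totalDegree` bookkeeping over `MvPolynomial` announced as eng/htc-sized is done there; the mathematics is §1 + the r2 gap count of ✓ `TriangularRow` §3):
   if the values of the affine pencil `B` lie in a NIL space `T₀ ⊔ S ⊆ M_b(ℂ)` with `T₀` strictly upper triangular in a constant
   coordinate flag `π`, `finrank S ≤ σ` and `rank A ≤ r` for every `A ∈ S`, then for every `q`,
   `RelCert n b B (σ + b·q + n·(r+2)·⌊(b-1)/(q+1)⌋)`; optimising `q` gives price `≤ σ + 2b·√((r+2)·n)`, i.e. **(c) with
   `c = 2√(r+2)` (+ `σ/(b√n)`) on the whole locus «triangular up to a skew part of bounded RANK»** — no loop-algebra hypothesis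
   (vs r11 `TransferDesign`), no gauge (vs r4), no invariant flag (vs r1/r2: the base point is NOT triangular).
   `RankRowConst` records the general-flag form (conjugate by a constant unit first, ✓ `SlowCore.ledger_top_of_conj`).

## Portrait consequence (memo §2) and the cell datum used

A violator of (c) in an open window must carry skew RANK `≥ c²/4 - 2` over EVERY constant triangular cut of codimension `≲ c√n·b`
(necessary, not sufficient: the tame TI/E(n) cores have return rank `2k` but transfer nil-index 2).  New irreducible species with
UNBOUNDED triangular defect but bounded return rank (`S₃^{(a)}(k)`: `b = k + 2a`, `μ = C(k,2) + 2a`, `δ_T = min(a, k-1)`, rank 2) are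
priced by this row at `c ≈ 4`.  CELL DATUM (CENSUS-GRID.md v0.7a, 2026-08-29T00:09Z §0/§B): `ι(6) ≥ 8` KERNEL ✓ p676238 — the
extremiser there is the S₃(6) design, return rank 2, hence inside this row's locus; every ✗-tail of the grid for `n ≤ 9` is kernel.

HONEST FRAMING: a calibration row and a typed signature; no law is asserted; (c) / 24318 OPEN; `VP ≠ VNP` NOT proved.
«Why novel»: Woodbury/Sherman–Morrison with a nilpotent capacitance as a DEGREE ledger for nil pencils whose base point is not
triangular is, as far as `lit search --hybrid "Woodbury nilpotent capacitance degree"` / `lit galaxy search "capacitance matrix|Woodbury" --star all`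
show (no relevant hit), not in print in this context; the identity itself is classical.
-/

set_option linter.dupNamespace false
set_option autoImplicit false

namespace Summit.ValiantsHypothesis.ValiantsHypothesis.Cruxes.DualUnipotentThreeHalves.RankRow

open scoped BigOperators
open Finset (range)

/-! ## §1 Woodbury with a nilpotent capacitance -/

section Ring

variable {R : Type*} [Ring R]

/-- **Capacitance.**  If `G ^ r = 0` then `N := ∑_{i<r} G^i` is a two-sided inverse of `1 - G`. -/
theorem one_sub_mul_geom_sum_of_pow_eq_zero (G : R) (r : ℕ) (hG : G ^ r = 0) :
    (1 - G) * (∑ i ∈ range r, G ^ i) = 1 := by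
  rw [mul_neg_geom_sum, hG, sub_zero]

theorem geom_sum_mul_one_sub_of_pow_eq_zero (G : R) (r : ℕ) (hG : G ^ r = 0) :
    (∑ i ∈ range r, G ^ i) * (1 - G) = 1 := by
  rw [geom_sum_mul_neg, hG, sub_zero]

/-- **Woodbury, right inverse.**  `M R' = 1` and `(1 - R' S) N = 1` give `(M - S)(R' + R' S N R') = 1`.
(In the rank row: `M = 1 - uA'`, `S = uS₀`, `R' = ∑ u^j A'^j`, `N` the capacitance of the nilpotent transfer `R' S`.) -/
theorem sub_mul_woodbury (M R' S N : R) (hMR : M * R' = 1) (hN : (1 - R' * S) * N = 1) :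
    (M - S) * (R' + R' * S * N * R') = 1 := by
  have h : (M - S) * (R' + R' * S * N * R')
      = M * R' + S * (((1 - R' * S) * N) - 1) * R' + (M * R' - 1) * S * N * R' := by
    noncomm_ring
  rw [h, hN, hMR]
  noncomm_ring

/-- **Woodbury, left inverse.**  `R' M = 1` and `N (1 - R' S) = 1` give `(R' + R' S N R')(M - S) = 1`. -/
theorem woodbury_mul_sub (M R' S N : R) (hRM : R' * M = 1) (hN : N * (1 - R' * S) = 1) :
    (R' + R' * S * N * R') * (M - S) = 1 := by
  have h : (R' + R' * S * N * R') * (M - S)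
      = R' * M + R' * S * ((N * (1 - R' * S)) - 1) + R' * S * N * (R' * M - 1) := by
    noncomm_ring
  rw [h, hN, hRM]
  noncomm_ring

/-- **Woodbury with a nilpotent capacitance** (the form used by the rank row): if `R'` is a two-sided inverse of `M` and the
transfer `G := R' * S` satisfies `G ^ r = 0`, then `R' + R' S (∑_{i<r} G^i) R'` is a two-sided inverse of `M - S`. -/
theorem woodbury_of_transfer_pow_eq_zero (M R' S : R) (r : ℕ) (hMR : M * R' = 1) (hRM : R' * M = 1)
    (hG : (R' * S) ^ r = 0) :
    (M - S) * (R' + R' * S * (∑ i ∈ range r, (R' * S) ^ i) * R') = 1 ∧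
      (R' + R' * S * (∑ i ∈ range r, (R' * S) ^ i) * R') * (M - S) = 1 :=
  ⟨sub_mul_woodbury M R' S _ hMR (one_sub_mul_geom_sum_of_pow_eq_zero _ r hG),
    woodbury_mul_sub M R' S _ hRM (geom_sum_mul_one_sub_of_pow_eq_zero _ r hG)⟩

/-- The resolvent form: with `M = 1 - A` and `R' = ∑_{j<h} A^j` for `A ^ h = 0`, the series of `A + S` is
`R' + R' S N R'` whenever the transfer `R' S` is nilpotent — `(1 - (A + S)) * (R' + R' S N R') = 1`. -/
theorem resolvent_add_of_transfer_pow_eq_zero (A S : R) (h r : ℕ) (hA : A ^ h = 0)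
    (hG : ((∑ j ∈ range h, A ^ j) * S) ^ r = 0) :
    (1 - (A + S)) * ((∑ j ∈ range h, A ^ j) + (∑ j ∈ range h, A ^ j) * S *
        (∑ i ∈ range r, ((∑ j ∈ range h, A ^ j) * S) ^ i) * (∑ j ∈ range h, A ^ j)) = 1 := by
  have h1 : (1 : R) - (A + S) = (1 - A) - S := by noncomm_ring
  rw [h1]
  exact (woodbury_of_transfer_pow_eq_zero (1 - A) _ S r
    (one_sub_mul_geom_sum_of_pow_eq_zero A h hA) (geom_sum_mul_one_sub_of_pow_eq_zero A h hA) hG).1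

end Ring

/-! ## §2 The rank row as a typed provider signature (✓ `SlowCore.RelCert` currency; statement only) -/

open Summit.ValiantsHypothesis.ValiantsHypothesis.Cruxes.TwoDimCoefficients.DimTwoCases (AffMat IsAffine)
open Summit.ValiantsHypothesis.ValiantsHypothesis.Theorems.GrenetZeon.SlowCore (Ledger RelCert)

/-- **r12 RANK ROW** (coordinate-flag form).  Values of the affine pencil `B` in a nil space `T₀ ⊔ S`, `T₀` strictly upper
triangular for the coordinate order `π`, `finrank S ≤ σ`, every element of `S` of rank `≤ r` ⇒ for every `q`,
`RelCert n b B (σ + b·q + n·((r+2)·⌊(b-1)/(q+1)⌋))`.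
Proof (memo §1): freeze `K' := lin⁻¹(T₀ ∩ 𝔫_{>q})` (codim `≤ σ + b q`); along `v ∈ K'`, `B(x + s v) = A' + S₀` with
`A' ∈ T₀[s]` carrying `s` only on gap-`> q` letters and `S₀ ∈ S` constant in `s`; expand `∑_p u^p (A' + S₀)^p` by
`resolvent_add_of_transfer_pow_eq_zero` (§1) with `r + 1` in place of `r` (rank `≤ r` & nilpotent ⇒ index `≤ r + 1`);
every `u`-coefficient has `deg_s ≤ κ + r κ + κ`, `κ = ⌊(b-1)/(q+1)⌋` (✓ `TriangularRow` §3 gap count). -/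
def RankRow : Prop :=
  ∀ (n b : ℕ) (B : AffMat n b), IsAffine B →
  ∀ (π : Equiv.Perm (Fin b)) (T₀ S : Submodule ℂ (Matrix (Fin b) (Fin b) ℂ)) (σ r : ℕ),
    (∀ A ∈ T₀, ∀ i j : Fin b, π j ≤ π i → A i j = 0) →
    Module.finrank ℂ S ≤ σ →
    (∀ A ∈ S, A.rank ≤ r) →
    (∀ A ∈ T₀ ⊔ S, IsNilpotent A) →
    (∀ x : Fin n × Fin n → ℂ, B.map (MvPolynomial.eval x) ∈ T₀ ⊔ S) →
    ∀ q : ℕ, RelCert n b B (σ + b * q + n * ((r + 2) * ((b - 1) / (q + 1))))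

/-- **r12, general constant flag**: the same with `T₀` strictly upper triangular after conjugation by a constant unit `P`
(reduce to `RankRow` by ✓ `SlowCore.ledger_top_of_conj`). -/
def RankRowConst : Prop :=
  ∀ (n b : ℕ) (B : AffMat n b), IsAffine B →
  ∀ (P : (Matrix (Fin b) (Fin b) ℂ)ˣ) (T₀ S : Submodule ℂ (Matrix (Fin b) (Fin b) ℂ)) (σ r : ℕ),
    (∀ A ∈ T₀, ∀ i j : Fin b, j ≤ i → ((P : Matrix (Fin b) (Fin b) ℂ) * A * (↑P⁻¹ : Matrix (Fin b) (Fin b) ℂ)) i j = 0) →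
    Module.finrank ℂ S ≤ σ →
    (∀ A ∈ S, A.rank ≤ r) →
    (∀ A ∈ T₀ ⊔ S, IsNilpotent A) →
    (∀ x : Fin n × Fin n → ℂ, B.map (MvPolynomial.eval x) ∈ T₀ ⊔ S) →
    ∀ q : ℕ, RelCert n b B (σ + b * q + n * ((r + 2) * ((b - 1) / (q + 1))))

/-- Bookkeeping: the coordinate form is the case `P = permutation matrix` of the general form — recorded as the trivial
monotonicity of the price in `σ` (a larger skew budget certifies at a larger price), which is how callers combine rows. -/
theorem price_mono {σ σ' b q n r : ℕ} (h : σ ≤ σ') :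
    σ + b * q + n * ((r + 2) * ((b - 1) / (q + 1))) ≤ σ' + b * q + n * ((r + 2) * ((b - 1) / (q + 1))) := by
  omega


/-! ## §3 (REV 2) PROOF of the rank row: `theorem rankRow_holds : RankRow` -/

noncomputable section

open MvPolynomial Matrix
open scoped Polynomial
open Summit.ValiantsHypothesis.ValiantsHypothesis.Theorems.GrenetZeon.ResolventFlag (SRing cst)

/-! ## §P The `s`-pencil `A + s·L` of two complex matrices -/

section Pencil
variable {b : ℕ}

/-- `A + s·L` as a matrix over `ℂ[s]` (`s = X 0`). -/
def pencilS (A L : Matrix (Fin b) (Fin b) ℂ) : Matrix (Fin b) (Fin b) SRing :=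
  A.map C + (X 0 : SRing) • L.map C

theorem pencilS_map_eval (A L : Matrix (Fin b) (Fin b) ℂ) (y : Fin 1 → ℂ) :
    (pencilS A L).map (eval y) = A + y 0 • L := by
  ext i j
  simp [pencilS, Matrix.map_apply, Matrix.add_apply, Matrix.smul_apply]

theorem pencilS_pow_map_eval (A L : Matrix (Fin b) (Fin b) ℂ) (y : Fin 1 → ℂ) (k : ℕ) :
    ((pencilS A L) ^ k).map (eval y) = (A + y 0 • L) ^ k := by
  rw [Matrix.map_pow (pencilS A L) (eval y : SRing →+* ℂ) k]
  change ((pencilS A L).map (eval y)) ^ k = _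
  rw [pencilS_map_eval]

/-- Pointwise nilpotency along the line gives nilpotency over `ℂ[s]`. -/
theorem pencilS_pow_eq_zero (A L : Matrix (Fin b) (Fin b) ℂ) (k : ℕ)
    (h : ∀ s : ℂ, (A + s • L) ^ k = 0) : (pencilS A L) ^ k = 0 := by
  refine Matrix.ext fun i j => ?_
  apply MvPolynomial.funext
  intro y
  have h1 : eval y (((pencilS A L) ^ k) i j) = (((pencilS A L) ^ k).map (eval y)) i j := rfl
  rw [h1, pencilS_pow_map_eval, h (y 0)]
  simp

end Pencil

/-! ## §A Admissible matrices over `ℂ[s]`: `s^e` in entry `(i,i')` only if `e ≤ j` and `j + e·q + π i ≤ π i'` -/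

section Adm
variable {b : ℕ} (π : Equiv.Perm (Fin b)) (q : ℕ)

/-- Flag-banded of weight `j`: the `s^e`-coefficient of entry `(i, i')` vanishes unless `e ≤ j` and `j + e·q + π i ≤ π i'`. -/
def Adm (j : ℕ) (Y : Matrix (Fin b) (Fin b) SRing) : Prop :=
  ∀ (i i' : Fin b) (d : Fin 1 →₀ ℕ), coeff d (Y i i') ≠ 0 → d 0 ≤ j ∧ j + d 0 * q + (π i : ℕ) ≤ (π i' : ℕ)

variable {π q}

theorem adm_one : Adm π q 0 (1 : Matrix (Fin b) (Fin b) SRing) := by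
  intro i i' d hd
  rw [Matrix.one_apply] at hd
  by_cases hii : i = i'
  · subst hii
    rw [if_pos rfl, MvPolynomial.coeff_one] at hd
    by_cases hd0 : 0 = d
    · subst hd0; simp
    · rw [if_neg hd0] at hd; exact absurd rfl hd
  · rw [if_neg hii, coeff_zero] at hd; exact absurd rfl hd

theorem adm_mul {j k : ℕ} {Y Z : Matrix (Fin b) (Fin b) SRing} (hY : Adm π q j Y) (hZ : Adm π q k Z) :
    Adm π q (j + k) (Y * Z) := by
  classical
  intro i i' d hd
  rw [Matrix.mul_apply, coeff_sum] at hd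
  obtain ⟨l, -, hl⟩ := Finset.exists_ne_zero_of_sum_ne_zero hd
  rw [coeff_mul] at hl
  obtain ⟨x, hx, hxne⟩ := Finset.exists_ne_zero_of_sum_ne_zero hl
  rw [Finset.HasAntidiagonal.mem_antidiagonal] at hx
  rcases mul_ne_zero_iff.1 hxne with ⟨h1, h2⟩
  obtain ⟨hY1, hY2⟩ := hY i l x.1 h1
  obtain ⟨hZ1, hZ2⟩ := hZ l i' x.2 h2
  have hd' : d 0 = x.1 0 + x.2 0 := by rw [← hx]; rfl
  rw [hd', Nat.add_mul]
  constructor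
  · omega
  · omega

theorem adm_pow {Y : Matrix (Fin b) (Fin b) SRing} (hY : Adm π q 1 Y) (j : ℕ) : Adm π q j (Y ^ j) := by
  induction j with
  | zero => rw [pow_zero]; exact adm_one
  | succ j ih => rw [pow_succ]; exact adm_mul ih hY

/-- The pencil `A₀ + s·L` is admissible of weight `1` when `A₀` is strictly `π`-upper and `L` has `π`-gaps `> q`. -/
theorem adm_pencilS (A₀ L : Matrix (Fin b) (Fin b) ℂ)
    (hA₀ : ∀ i i' : Fin b, π i' ≤ π i → A₀ i i' = 0)
    (hL : ∀ i i' : Fin b, (π i' : ℕ) ≤ (π i : ℕ) + q → L i i' = 0) :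
    Adm π q 1 (pencilS A₀ L) := by
  classical
  intro i i' d hd
  simp only [pencilS, Matrix.add_apply, Matrix.smul_apply, Matrix.map_apply, smul_eq_mul, coeff_add, coeff_C,
    coeff_X_mul', coeff_C] at hd
  by_cases hd0 : 0 = d
  · subst hd0
    have hA : A₀ i i' ≠ 0 := by simpa using hd
    have hlt : π i < π i' := by
      by_contra hle; exact hA (hA₀ i i' (not_lt.1 hle))
    have hlt' : (π i : ℕ) < (π i' : ℕ) := hlt
    simp; omega
  · rw [if_neg hd0, zero_add] at hd
    by_cases hs : (Finsupp.single (0 : Fin 1) 1 : Fin 1 →₀ ℕ) ≤ d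
    · -- then the remaining coefficient is that of `C (L i i')` at `d - single 0 1`
      rw [if_pos (Finsupp.mem_support_iff.2 (by
        have : d 0 ≠ 0 := by
          intro h0
          have := hs 0
          simp [h0] at this
        simpa using this))] at hd
      by_cases hd1 : 0 = d - Finsupp.single (0 : Fin 1) 1
      · rw [if_pos hd1] at hd
        have hLne : L i i' ≠ 0 := hd
        have hgap : (π i : ℕ) + q < (π i' : ℕ) := by
          by_contra hle; exact hLne (hL i i' (not_lt.1 hle))
        have hdeq : d 0 = 1 := by
          have h := congrArg (fun f : Fin 1 →₀ ℕ => f 0) hd1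
          have h1 : 1 ≤ d 0 := by simpa using hs 0
          simp at h; omega
        rw [hdeq]; constructor
        · exact le_rfl
        · omega
      · rw [if_neg hd1] at hd; exact absurd rfl hd
    · rw [if_neg (by
        intro hmem
        apply hs
        intro t
        fin_cases t
        have : d 0 ≠ 0 := by simpa [Finsupp.mem_support_iff] using hmem
        simp; omega)] at hd
      exact absurd rfl hd

/-- An admissible matrix of weight `≥ b` vanishes. -/
theorem eq_zero_of_adm {j : ℕ} {Y : Matrix (Fin b) (Fin b) SRing} (hY : Adm π q j Y) (hj : b ≤ j) : Y = 0 := by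
  refine Matrix.ext fun i i' => ?_
  rw [Matrix.zero_apply]
  refine MvPolynomial.ext _ _ fun d => ?_
  rw [coeff_zero]
  by_contra hne
  have h := (hY i i' d hne).2
  have hlt : (π i' : ℕ) < b := (π i').isLt
  omega

/-- Entries of an admissible matrix have `s`-degree `≤ ⌊(b-1)/(q+1)⌋`. -/
theorem totalDegree_le_of_adm {j : ℕ} {Y : Matrix (Fin b) (Fin b) SRing} (hY : Adm π q j Y) (i i' : Fin b) :
    (Y i i').totalDegree ≤ (b - 1) / (q + 1) := by
  rw [MvPolynomial.totalDegree]
  refine Finset.sup_le fun d hd => ?_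
  have hne : coeff d (Y i i') ≠ 0 := MvPolynomial.mem_support_iff.1 hd
  obtain ⟨h1, h2⟩ := hY i i' d hne
  have hlt : (π i' : ℕ) < b := (π i').isLt
  have hsum : (d.sum fun _ e => e) = d 0 := by
    rw [Finsupp.sum_fintype _ _ (fun _ => rfl)]
    simp
  rw [hsum]
  have hq : 0 < q + 1 := Nat.succ_pos q
  refine (Nat.le_div_iff_mul_le hq).2 ?_
  have : d 0 * (q + 1) = d 0 * q + d 0 := by ring
  omega

end Adm

/-! ## §B Uniform `s`-degree of the `u`-coefficients of matrices over `ℂ[s][u]` -/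

section DegLE
variable {b : ℕ}

/-- Every `u`-coefficient of every entry has `s`-degree `≤ d`. -/
def DegLE (d : ℕ) (Z : Matrix (Fin b) (Fin b) (Polynomial SRing)) : Prop :=
  ∀ (i j : Fin b) (p : ℕ), (Polynomial.coeff (Z i j) p).totalDegree ≤ d

theorem degLE_mono {d d' : ℕ} {Z : Matrix (Fin b) (Fin b) (Polynomial SRing)} (h : DegLE d Z) (hd : d ≤ d') :
    DegLE d' Z := fun i j p => (h i j p).trans hd

theorem degLE_cst (P : Matrix (Fin b) (Fin b) ℂ) : DegLE 0 (cst P) := by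
  intro i j p
  rw [cst, Matrix.map_apply, Polynomial.coeff_C]
  split_ifs
  · exact (totalDegree_C _).le
  · rw [totalDegree_zero]

theorem degLE_one : DegLE 0 (1 : Matrix (Fin b) (Fin b) (Polynomial SRing)) := by
  intro i j p
  rw [Matrix.one_apply]
  split_ifs
  · rw [Polynomial.coeff_one]; split_ifs
    · exact (totalDegree_one).le
    · rw [totalDegree_zero]
  · rw [Polynomial.coeff_zero, totalDegree_zero]

theorem degLE_add {d : ℕ} {Z Z' : Matrix (Fin b) (Fin b) (Polynomial SRing)} (h : DegLE d Z) (h' : DegLE d Z') :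
    DegLE d (Z + Z') := by
  intro i j p
  rw [Matrix.add_apply, Polynomial.coeff_add]
  exact (totalDegree_add _ _).trans (max_le (h i j p) (h' i j p))

theorem degLE_sum {d : ℕ} {ι : Type*} (s : Finset ι) (f : ι → Matrix (Fin b) (Fin b) (Polynomial SRing))
    (h : ∀ a ∈ s, DegLE d (f a)) : DegLE d (∑ a ∈ s, f a) := by
  classical
  induction s using Finset.induction_on with
  | empty =>
    intro i j p
    rw [Finset.sum_empty, Matrix.zero_apply, Polynomial.coeff_zero, totalDegree_zero]; exact Nat.zero_le _
  | insert a s ha ih =>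
    rw [Finset.sum_insert ha]
    exact degLE_add (h a (Finset.mem_insert_self a s)) (ih fun x hx => h x (Finset.mem_insert_of_mem hx))

theorem degLE_mul {d d' : ℕ} {Z Z' : Matrix (Fin b) (Fin b) (Polynomial SRing)} (h : DegLE d Z) (h' : DegLE d' Z') :
    DegLE (d + d') (Z * Z') := by
  classical
  intro i j p
  rw [Matrix.mul_apply, Polynomial.finsetSum_coeff]
  refine (totalDegree_finsetSum _ _).trans (Finset.sup_le fun l _ => ?_)
  rw [Polynomial.coeff_mul]
  refine (totalDegree_finsetSum _ _).trans (Finset.sup_le fun x _ => ?_)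
  exact (totalDegree_mul _ _).trans (add_le_add (h i l x.1) (h' l j x.2))

theorem degLE_pow {d : ℕ} {Z : Matrix (Fin b) (Fin b) (Polynomial SRing)} (h : DegLE d Z) (k : ℕ) :
    DegLE (k * d) (Z ^ k) := by
  induction k with
  | zero => rw [pow_zero, zero_mul]; exact degLE_one
  | succ k ih => rw [pow_succ, Nat.succ_mul]; exact degLE_mul ih h

theorem degLE_X_mul {d : ℕ} {Z : Matrix (Fin b) (Fin b) (Polynomial SRing)} (h : DegLE d Z) :
    DegLE d ((Polynomial.X : Polynomial SRing) • Z) := by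
  intro i j p
  rw [Matrix.smul_apply, smul_eq_mul]
  cases p with
  | zero => rw [Polynomial.coeff_X_mul_zero, totalDegree_zero]; exact Nat.zero_le _
  | succ p => rw [Polynomial.coeff_X_mul]; exact h i j p

/-- `u^j • (Y.map C)` has `u`-coefficients of `s`-degree `≤ d` if the entries of `Y` have `s`-degree `≤ d`. -/
theorem degLE_X_pow_smul_map_C {d : ℕ} (Y : Matrix (Fin b) (Fin b) SRing) (hY : ∀ i j, (Y i j).totalDegree ≤ d) (k : ℕ) :
    DegLE d ((Polynomial.X : Polynomial SRing) ^ k • Y.map Polynomial.C) := by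
  intro i j p
  rw [Matrix.smul_apply, smul_eq_mul, Matrix.map_apply, mul_comm, Polynomial.coeff_C_mul_X_pow]
  split_ifs
  · exact hY i j
  · rw [totalDegree_zero]; exact Nat.zero_le _

end DegLE


/-! ## §C Transfer nilpotency: `G = R_{A'}(u)·(u S₀)` is nilpotent over `ℂ[s][u]`

Rings: `SRing = ℂ[s]`, `URing = ℂ[s][u]`, `TRing = ℂ[s][u][t]`. -/

/-- `ℂ[s][u]`. -/
abbrev URing : Type := Polynomial SRing
/-- `ℂ[s][u][t]`. -/
abbrev TRing : Type := Polynomial URing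

section Transfer
variable {b : ℕ}

theorem map_smul_ringHom {R S : Type*} [CommSemiring R] [Semiring S] {ι κ : Type*} (f : R →+* S) (r : R)
    (M : Matrix ι κ R) : (r • M).map f = f r • M.map f := by
  ext i j; simp [Matrix.map_apply, smul_eq_mul]

/-- A general constant embedding `ℂ → ℂ[s][u]` on rectangular matrices (agrees with `cst` on square ones). -/
def cmat {ι κ : Type*} (P : Matrix ι κ ℂ) : Matrix ι κ URing :=
  P.map ((Polynomial.C : SRing →+* URing).comp (C : ℂ →+* SRing))

theorem cmat_eq_cst (P : Matrix (Fin b) (Fin b) ℂ) : cmat P = cst P := rfl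

theorem cmat_mul {ι κ μ : Type*} [Fintype κ] (P : Matrix ι κ ℂ) (Q : Matrix κ μ ℂ) :
    cmat (P * Q) = cmat P * cmat Q := by
  rw [cmat, cmat, cmat, Matrix.map_mul]

/-- The two-parameter pencil `A' + t·S₀` over `ℂ[s][u][t]` is nilpotent if `A' + t₀ S₀` is for every complex `t₀`. -/
theorem pencilT_pow_eq_zero (A₀ L S₀ : Matrix (Fin b) (Fin b) ℂ)
    (h : ∀ t₀ : ℂ, (pencilS (A₀ + t₀ • S₀) L) ^ b = 0) :
    (((pencilS A₀ L).map (Polynomial.C : SRing →+* URing)).map (Polynomial.C : URing →+* TRing)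
      + (Polynomial.X : TRing) • (cst S₀).map (Polynomial.C : URing →+* TRing)) ^ b = 0 := by
  classical
  set Mt := ((pencilS A₀ L).map (Polynomial.C : SRing →+* URing)).map (Polynomial.C : URing →+* TRing)
      + (Polynomial.X : TRing) • (cst S₀).map (Polynomial.C : URing →+* TRing) with hMt
  -- evaluation of `Mt` at a complex constant `t₀`
  have heval : ∀ t₀ : ℂ, Mt.map (Polynomial.evalRingHom (Polynomial.C (C t₀ : SRing) : URing)) =
      (pencilS (A₀ + t₀ • S₀) L).map (Polynomial.C : SRing →+* URing) := by
    intro t₀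
    refine Matrix.ext fun i j => ?_
    simp only [hMt, Matrix.map_apply, Matrix.add_apply, Matrix.smul_apply, smul_eq_mul, pencilS, cst,
      Polynomial.coe_evalRingHom, Polynomial.eval_add, Polynomial.eval_C, Polynomial.eval_mul, Polynomial.eval_X]
    simp only [map_add, map_mul]
    ring
  refine Matrix.ext fun i j => ?_
  rw [Matrix.zero_apply]
  apply Polynomial.eq_zero_of_infinite_isRoot
  refine Set.Infinite.mono (s := Set.range fun t₀ : ℂ => (Polynomial.C (C t₀ : SRing) : URing)) ?_ ?_
  · rintro _ ⟨t₀, rfl⟩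
    show Polynomial.IsRoot ((Mt ^ b) i j) _
    rw [Polynomial.IsRoot.def]
    have h1 : Polynomial.eval (Polynomial.C (C t₀ : SRing) : URing) ((Mt ^ b) i j) =
        ((Mt ^ b).map (Polynomial.evalRingHom (Polynomial.C (C t₀ : SRing) : URing))) i j := rfl
    rw [h1, Matrix.map_pow, heval t₀, ← Matrix.map_pow, h t₀, Matrix.map_apply, Matrix.zero_apply, map_zero]
  · exact Set.infinite_range_of_injective
      (Polynomial.C_injective.comp (MvPolynomial.C_injective (Fin 1) ℂ))

/-- `t`-coefficientwise projection `M_b(K[t]) → M_b(K)`. -/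
def tcoeff {K : Type*} [CommRing K] (k : ℕ) (Z : Matrix (Fin b) (Fin b) (Polynomial K)) : Matrix (Fin b) (Fin b) K :=
  fun i j => (Z i j).coeff k

/-- **Transfer nilpotency** (generic commutative ring `K`, `u ∈ K`). If `A^b = 0` and `(A + t S)^b = 0` over `K[t]`, then
`G = (Σ_{j<b} (uA)^j)·(uS)` is nilpotent over `K`. -/
theorem isNilpotent_transfer {K : Type*} [CommRing K] (u : K) (Au Su : Matrix (Fin b) (Fin b) K) (hAu : Au ^ b = 0)
    (hMt : (Au.map (Polynomial.C : K →+* Polynomial K) + (Polynomial.X : Polynomial K) •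
      Su.map (Polynomial.C : K →+* Polynomial K)) ^ b = 0) :
    IsNilpotent ((∑ j ∈ Finset.range b, (u • Au) ^ j) * (u • Su)) := by
  classical
  set R' : Matrix (Fin b) (Fin b) K := ∑ j ∈ Finset.range b, (u • Au) ^ j with hR'
  set G : Matrix (Fin b) (Fin b) K := R' * (u • Su) with hG
  set Ct : K →+* Polynomial K := Polynomial.C with hCt
  set t : Polynomial K := Polynomial.X with ht
  set At : Matrix (Fin b) (Fin b) (Polynomial K) := Au.map Ct with hAt
  set St : Matrix (Fin b) (Fin b) (Polynomial K) := Su.map Ct with hSt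
  set Gt : Matrix (Fin b) (Fin b) (Polynomial K) := G.map Ct with hGt
  set Rt : Matrix (Fin b) (Fin b) (Polynomial K) := R'.map Ct with hRt
  set ut : Polynomial K := Ct u with hut
  set Mt : Matrix (Fin b) (Fin b) (Polynomial K) := At + t • St with hMt'
  -- (1) `R'` is a two-sided inverse of `1 - u A'`
  have hx : (u • Au) ^ b = 0 := by rw [smul_pow, hAu, smul_zero]
  have hinv1 : (1 - u • Au) * R' = 1 := by rw [hR', mul_neg_geom_sum, hx, sub_zero]
  have hinv2 : R' * (1 - u • Au) = 1 := by rw [hR', geom_sum_mul_neg, hx, sub_zero]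
  -- transported to `K[t]`
  have hmap_uAu : (u • Au).map Ct = ut • At := by rw [hut, hAt]; exact map_smul_ringHom Ct u Au
  have hinv1t : (1 - ut • At) * Rt = 1 := by
    have h0 := congrArg Ct.mapMatrix hinv1
    simp only [map_mul, map_sub, map_one, RingHom.mapMatrix_apply] at h0
    rw [hmap_uAu] at h0
    exact h0
  have hinv2t : Rt * (1 - ut • At) = 1 := by
    have h0 := congrArg Ct.mapMatrix hinv2
    simp only [map_mul, map_sub, map_one, RingHom.mapMatrix_apply] at h0
    rw [hmap_uAu] at h0
    exact h0
  have hGt' : Gt = Rt * (ut • St) := by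
    rw [hGt, hG, Matrix.map_mul, hRt, hut, hSt, map_smul_ringHom]
  -- (2) factorisation `1 - u·Mt = (1 - u A')(1 - t G)`
  have hfact : (1 - ut • At) * (1 - t • Gt) = 1 - ut • Mt := by
    calc (1 - ut • At) * (1 - t • Gt)
        = (1 - ut • At) - t • (((1 - ut • At) * Rt) * (ut • St)) := by
          rw [mul_sub, mul_one, hGt', Matrix.mul_smul, Matrix.mul_assoc]
      _ = 1 - ut • Mt := by
          rw [hinv1t, Matrix.one_mul, hMt', smul_add, smul_comm t ut St, sub_sub]
  -- (3) `Mt^b = 0` gives the geometric inverse of `1 - u·Mt`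
  have hy : (ut • Mt) ^ b = 0 := by rw [smul_pow, hMt, smul_zero]
  set Sg : Matrix (Fin b) (Fin b) (Polynomial K) := ∑ p ∈ Finset.range b, (ut • Mt) ^ p with hSg
  have hgeo1 : (1 - ut • Mt) * Sg = 1 := by rw [hSg, mul_neg_geom_sum, hy, sub_zero]
  -- (4) `(1 - tG) Q = 1` with `Q = Sg (1 - uA')`
  have hX : (1 - t • Gt) * Sg = Rt := by
    calc (1 - t • Gt) * Sg = (Rt * (1 - ut • At)) * ((1 - t • Gt) * Sg) := by rw [hinv2t, Matrix.one_mul]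
      _ = Rt * (((1 - ut • At) * (1 - t • Gt)) * Sg) := by simp only [Matrix.mul_assoc]
      _ = Rt := by rw [hfact, hgeo1, Matrix.mul_one]
  set Q : Matrix (Fin b) (Fin b) (Polynomial K) := Sg * (1 - ut • At) with hQ
  have hQ1 : (1 - t • Gt) * Q = 1 := by rw [hQ, ← Matrix.mul_assoc, hX, hinv2t]
  have hQrec : Q = (1 : Matrix (Fin b) (Fin b) K).map Ct + t • (Gt * Q) := by
    have h0 : Q - t • (Gt * Q) = 1 := by
      rw [sub_mul, Matrix.one_mul, Matrix.smul_mul] at hQ1; exact hQ1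
    rw [Matrix.map_one Ct (map_zero Ct) (map_one Ct)]
    rw [← h0]; abel
  -- (5) coefficient recursion: `tcoeff k Q = G^k`
  have hcoeff : ∀ k : ℕ, tcoeff k Q = G ^ k := by
    intro k
    induction k with
    | zero =>
      refine Matrix.ext fun i j => ?_
      show (Q i j).coeff 0 = (G ^ 0) i j
      rw [hQrec, Matrix.add_apply, Matrix.smul_apply, smul_eq_mul, Polynomial.coeff_add, Matrix.map_apply,
        hCt, Polynomial.coeff_C_zero, ht, Polynomial.coeff_X_mul_zero, add_zero, pow_zero]
    | succ k ih =>
      refine Matrix.ext fun i j => ?_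
      show (Q i j).coeff (k + 1) = (G ^ (k + 1)) i j
      rw [hQrec, Matrix.add_apply, Matrix.smul_apply, smul_eq_mul, Polynomial.coeff_add, Matrix.map_apply,
        hCt, Polynomial.coeff_C, if_neg (Nat.succ_ne_zero k), zero_add, ht, Polynomial.coeff_X_mul, Matrix.mul_apply,
        Polynomial.finsetSum_coeff, pow_succ', ← ih, Matrix.mul_apply]
      refine Finset.sum_congr rfl fun l _ => ?_
      rw [hGt, Matrix.map_apply, Polynomial.coeff_C_mul]
      rfl
  -- (6) a `t`-degree bound on `Q` kills a power of `G`
  clear_value Q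
  obtain ⟨D, hDlt⟩ : ∃ D : ℕ, ∀ i j : Fin b, (Q i j).natDegree < D := by
    refine ⟨(Finset.univ : Finset (Fin b × Fin b)).sup (fun ij => (Q ij.1 ij.2).natDegree) + 1, fun i j => ?_⟩
    have hle := Finset.le_sup (f := fun ij : Fin b × Fin b => (Q ij.1 ij.2).natDegree) (Finset.mem_univ (i, j))
    simp only at hle
    omega
  refine ⟨D, ?_⟩
  rw [← hcoeff D]
  refine Matrix.ext fun i j => ?_
  show (Q i j).coeff D = 0
  exact Polynomial.coeff_eq_zero_of_natDegree_lt (hDlt i j)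

end Transfer

/-! ## §D Rank reduction: `G = E·F` through `ℂ[s][u]^{rank S₀}`, so `G^{rank S₀ + 1} = 0` -/

section RankReduction
variable {b : ℕ}

/-- Rank factorisation of a complex matrix through `ℂ^{rank}`. -/
theorem exists_rank_factorisation (S₀ : Matrix (Fin b) (Fin b) ℂ) :
    ∃ (P : Matrix (Fin b) (Fin S₀.rank) ℂ) (Q : Matrix (Fin S₀.rank) (Fin b) ℂ), S₀ = P * Q := by
  classical
  let V : Submodule ℂ (Fin b → ℂ) := LinearMap.range S₀.mulVecLin
  let bV : Module.Basis (Fin S₀.rank) ℂ V := Module.finBasis ℂ V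
  have hmem : ∀ j : Fin b, S₀.mulVecLin (Pi.single j 1) ∈ V := fun j => LinearMap.mem_range_self _ _
  refine ⟨fun i a => ((bV a : V) : Fin b → ℂ) i, fun a j => bV.repr ⟨_, hmem j⟩ a, ?_⟩
  refine Matrix.ext fun i j => ?_
  have h1 : S₀ i j = ((⟨_, hmem j⟩ : V) : Fin b → ℂ) i := by
    simp
  rw [h1, ← bV.sum_repr ⟨_, hmem j⟩]
  simp only [Matrix.mul_apply, Submodule.coe_sum, Submodule.coe_smul, Finset.sum_apply, Pi.smul_apply,
    smul_eq_mul]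
  refine Finset.sum_congr rfl fun a _ => ?_
  exact mul_comm _ _

/-- Powers of `E·F` factor through `F·E`: `(EF)^{k+1} = E (FE)^k F`. -/
theorem mul_pow_succ_eq {K : Type*} [CommRing K] {c : ℕ} (E : Matrix (Fin b) (Fin c) K) (F : Matrix (Fin c) (Fin b) K)
    (k : ℕ) : (E * F) ^ (k + 1) = E * (F * E) ^ k * F := by
  induction k with
  | zero => rw [zero_add, pow_one, pow_zero, Matrix.mul_one]
  | succ k ih =>
    rw [pow_succ, ih, pow_succ]
    simp only [Matrix.mul_assoc]

/-- **Rank reduction**: a nilpotent `E·F` with inner dimension `c` over a domain satisfies `(EF)^{c+1} = 0`. -/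
theorem pow_succ_eq_zero_of_isNilpotent_mul {K : Type*} [CommRing K] [IsDomain K] {c : ℕ}
    (E : Matrix (Fin b) (Fin c) K) (F : Matrix (Fin c) (Fin b) K) (h : IsNilpotent (E * F)) :
    (E * F) ^ (c + 1) = 0 := by
  obtain ⟨D, hD⟩ := h
  have hH : (F * E) ^ (D + 1) = 0 := by
    rw [mul_pow_succ_eq F E D, hD, Matrix.mul_zero, Matrix.zero_mul]
  have hHc : (F * E) ^ c = 0 :=
    Summit.ValiantsHypothesis.ValiantsHypothesis.Theorems.GrenetZeon.SlowCore.pow_card_eq_zero_of_pow_eq_zero _ hH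
  rw [mul_pow_succ_eq, hHc, Matrix.mul_zero, Matrix.zero_mul]

end RankReduction


/-! ## §E Extraction: Woodbury expansion of `(1 - u·M)⁻¹` and `u`-coefficient comparison -/

section Extraction
variable {b : ℕ}

theorem map_C_pencilS_add (A₀ L S₀ : Matrix (Fin b) (Fin b) ℂ) :
    (pencilS (A₀ + S₀) L).map (Polynomial.C : SRing →+* URing) =
      (pencilS A₀ L).map (Polynomial.C : SRing →+* URing) + cst S₀ := by
  refine Matrix.ext fun i j => ?_
  simp only [pencilS, cst, Matrix.map_apply, Matrix.add_apply, Matrix.smul_apply, smul_eq_mul, map_add, map_mul]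
  ring

/-- **Extraction.** If `A' = A₀ + sL` is admissible of weight 1 and the transfer matrix `G = R_{A'}(u)(u S₀)` satisfies
`G^{r+1} = 0`, then every power of `M = A' + S₀` has entries of `s`-degree `≤ (r+2)·⌊(b-1)/(q+1)⌋`. -/
theorem totalDegree_pow_le_of_transfer_pow_eq_zero (π : Equiv.Perm (Fin b)) (q r : ℕ)
    (A₀ L S₀ : Matrix (Fin b) (Fin b) ℂ) (hA' : Adm π q 1 (pencilS A₀ L))
    (hG : ((∑ j ∈ Finset.range b,
        ((Polynomial.X : URing) • (pencilS A₀ L).map (Polynomial.C : SRing →+* URing)) ^ j) *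
      ((Polynomial.X : URing) • cst S₀)) ^ (r + 1) = 0)
    (p : ℕ) (i j : Fin b) :
    (((pencilS (A₀ + S₀) L) ^ p) i j).totalDegree ≤ (r + 2) * ((b - 1) / (q + 1)) := by
  classical
  set κ : ℕ := (b - 1) / (q + 1) with hκ
  set A' : Matrix (Fin b) (Fin b) SRing := pencilS A₀ L with hA'def
  set M : Matrix (Fin b) (Fin b) SRing := pencilS (A₀ + S₀) L with hM
  set u : URing := Polynomial.X with hu
  set Au : Matrix (Fin b) (Fin b) URing := A'.map (Polynomial.C : SRing →+* URing) with hAu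
  set Su : Matrix (Fin b) (Fin b) URing := cst S₀ with hSu
  set Mu : Matrix (Fin b) (Fin b) URing := M.map (Polynomial.C : SRing →+* URing) with hMu
  set R' : Matrix (Fin b) (Fin b) URing := ∑ j ∈ Finset.range b, (u • Au) ^ j with hR'
  set G : Matrix (Fin b) (Fin b) URing := R' * (u • Su) with hGdef
  set N : Matrix (Fin b) (Fin b) URing := ∑ a ∈ Finset.range (r + 1), G ^ a with hN
  set W : Matrix (Fin b) (Fin b) URing := R' + R' * (u • Su) * N * R' with hW
  -- nilpotency of `A'` and of `u • Au`
  have hAb : A' ^ b = 0 := eq_zero_of_adm (adm_pow hA' b) le_rfl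
  have hx : (u • Au) ^ b = 0 := by
    rw [smul_pow, hAu, ← Matrix.map_pow A' (Polynomial.C : SRing →+* URing) b, hAb,
      Matrix.map_zero _ (map_zero _), smul_zero]
  -- (1) Woodbury: `(1 - u·Mu) W = 1`
  have hMu' : Mu = Au + Su := by
    rw [hMu, hM, hAu, hSu, hA'def]; exact map_C_pencilS_add A₀ L S₀
  have h5 : (1 - u • Mu) * W = 1 := by
    have h := resolvent_add_of_transfer_pow_eq_zero (u • Au) (u • Su) b (r + 1) hx hG
    rw [hMu', smul_add]; exact h
  -- (2) geometric sum for `u·Mu`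
  have h6 : (∑ a ∈ Finset.range (p + 1), (u • Mu) ^ a) = W - (u • Mu) ^ (p + 1) * W := by
    have hgs : (∑ a ∈ Finset.range (p + 1), (u • Mu) ^ a) * (1 - u • Mu) = 1 - (u • Mu) ^ (p + 1) :=
      geom_sum_mul_neg _ _
    calc (∑ a ∈ Finset.range (p + 1), (u • Mu) ^ a)
        = (∑ a ∈ Finset.range (p + 1), (u • Mu) ^ a) * ((1 - u • Mu) * W) := by rw [h5, Matrix.mul_one]
      _ = (1 - (u • Mu) ^ (p + 1)) * W := by rw [← Matrix.mul_assoc, hgs]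
      _ = W - (u • Mu) ^ (p + 1) * W := by rw [sub_mul, Matrix.one_mul]
  have hterm : ∀ a : ℕ, Polynomial.coeff (((u • Mu) ^ a) i j) p = if p = a then (M ^ a) i j else 0 := by
    intro a
    rw [smul_pow, Matrix.smul_apply, smul_eq_mul, hMu, ← Matrix.map_pow M (Polynomial.C : SRing →+* URing) a]
    change Polynomial.coeff (u ^ a * Polynomial.C ((M ^ a) i j)) p = _
    rw [mul_comm, hu, Polynomial.coeff_C_mul_X_pow]
  have hL : Polynomial.coeff ((∑ a ∈ Finset.range (p + 1), (u • Mu) ^ a) i j) p = (M ^ p) i j := by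
    rw [Matrix.sum_apply, Polynomial.finsetSum_coeff,
      Finset.sum_eq_single_of_mem p (Finset.mem_range.2 (Nat.lt_succ_self p))
        (fun a _ hap => by rw [hterm a, if_neg (Ne.symm hap)]), hterm p, if_pos rfl]
  have hR2 : Polynomial.coeff ((((u • Mu) ^ (p + 1)) * W) i j) p = 0 := by
    rw [smul_pow, Matrix.smul_mul, Matrix.smul_apply, smul_eq_mul, hu, Polynomial.coeff_X_pow_mul', if_neg (by omega)]
  -- (3) degrees
  have hdegR' : DegLE κ R' := by
    refine degLE_sum _ _ fun a _ => ?_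
    rw [smul_pow, hAu, ← Matrix.map_pow A' (Polynomial.C : SRing →+* URing) a]
    exact degLE_X_pow_smul_map_C (A' ^ a) (fun i j => totalDegree_le_of_adm (adm_pow hA' a) i j) a
  have hdegSu : DegLE 0 (u • Su) := by rw [hu, hSu]; exact degLE_X_mul (degLE_cst S₀)
  have hdegG : DegLE κ G := by
    have h := degLE_mul hdegR' hdegSu
    rw [Nat.add_zero] at h
    exact h
  have hdegN : DegLE (r * κ) N := by
    refine degLE_sum _ _ fun a ha => ?_
    have har : a ≤ r := Nat.lt_succ_iff.1 (Finset.mem_range.1 ha)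
    exact degLE_mono (degLE_pow hdegG a) (Nat.mul_le_mul_right κ har)
  have hdegW : DegLE ((r + 2) * κ) W := by
    have h := degLE_mul (degLE_mul (degLE_mul hdegR' hdegSu) hdegN) hdegR'
    have hk : κ + 0 + r * κ + κ = (r + 2) * κ := by ring
    rw [hk] at h
    exact degLE_add (degLE_mono hdegR' (Nat.le_mul_of_pos_left κ (by omega))) h
  -- (4) conclusion
  have hcoef : Polynomial.coeff ((∑ a ∈ Finset.range (p + 1), (u • Mu) ^ a) i j) p =
      Polynomial.coeff ((W - (u • Mu) ^ (p + 1) * W) i j) p := by rw [h6]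
  rw [hL, Matrix.sub_apply, Polynomial.coeff_sub, hR2, sub_zero] at hcoef
  rw [hcoef]
  exact hdegW i j p

end Extraction

/-! ## §F The core bound and the assembly of `RankRow` -/

section Core
variable {b : ℕ}

/-- **Core bound.**  `A₀` strictly `π`-upper, `L` strictly `π`-upper with gaps `> q`, `A₀ + sL + tS₀` nilpotent for all
`s t ∈ ℂ`, `rank S₀ ≤ r`  ⟹  every power of `A₀ + S₀ + sL` has entries of `s`-degree `≤ (r+2)·⌊(b-1)/(q+1)⌋`. -/
theorem totalDegree_pow_le_core (π : Equiv.Perm (Fin b)) (q r : ℕ) (A₀ L S₀ : Matrix (Fin b) (Fin b) ℂ)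
    (hA₀ : ∀ i i' : Fin b, π i' ≤ π i → A₀ i i' = 0)
    (hL : ∀ i i' : Fin b, (π i' : ℕ) ≤ (π i : ℕ) + q → L i i' = 0)
    (hnil : ∀ s t : ℂ, (A₀ + s • L + t • S₀) ^ b = 0) (hrank : S₀.rank ≤ r) (p : ℕ) (i j : Fin b) :
    (((pencilS (A₀ + S₀) L) ^ p) i j).totalDegree ≤ (r + 2) * ((b - 1) / (q + 1)) := by
  classical
  have hA' : Adm π q 1 (pencilS A₀ L) := adm_pencilS A₀ L hA₀ hL
  have hAb : (pencilS A₀ L) ^ b = 0 := eq_zero_of_adm (adm_pow hA' b) le_rfl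
  set u : URing := Polynomial.X with hu
  set Au : Matrix (Fin b) (Fin b) URing := (pencilS A₀ L).map (Polynomial.C : SRing →+* URing) with hAu
  have hAub : Au ^ b = 0 := by
    rw [hAu, ← Matrix.map_pow (pencilS A₀ L) (Polynomial.C : SRing →+* URing) b, hAb, Matrix.map_zero _ (map_zero _)]
  -- two-parameter nilpotency, transported to `ℂ[s][u][t]`
  have hMt := pencilT_pow_eq_zero A₀ L S₀ (fun t₀ => pencilS_pow_eq_zero (A₀ + t₀ • S₀) L b (fun s => by
    have h := hnil s t₀
    rwa [add_right_comm] at h))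
  -- transfer nilpotency
  have hGnil : IsNilpotent ((∑ j ∈ Finset.range b, (u • Au) ^ j) * (u • cst S₀)) :=
    isNilpotent_transfer u Au (cst S₀) hAub hMt
  -- rank reduction
  obtain ⟨P, Q₀, hPQ⟩ := exists_rank_factorisation S₀
  set R' : Matrix (Fin b) (Fin b) URing := ∑ j ∈ Finset.range b, (u • Au) ^ j with hR'
  have hcS : cst S₀ = cmat P * cmat Q₀ := by
    rw [← cmat_eq_cst]; exact (congrArg cmat hPQ).trans (cmat_mul P Q₀)
  have hGEF : R' * (u • cst S₀) = (R' * (u • cmat P)) * cmat Q₀ := by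
    rw [hcS, ← Matrix.smul_mul, ← Matrix.mul_assoc]
  have hGr : (R' * (u • cst S₀)) ^ (r + 1) = 0 := by
    have h1 : (R' * (u • cst S₀)) ^ (S₀.rank + 1) = 0 := by
      rw [hGEF] at hGnil ⊢
      exact pow_succ_eq_zero_of_isNilpotent_mul _ _ hGnil
    exact pow_eq_zero_of_le (by omega) h1
  exact totalDegree_pow_le_of_transfer_pow_eq_zero π q r A₀ L S₀ hA' hGr p i j

end Core

section Assembly

open Summit.ValiantsHypothesis.ValiantsHypothesis.Cruxes.TwoDimCoefficients.DimTwoCases (AffMat IsAffine)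
open Summit.ValiantsHypothesis.ValiantsHypothesis.Theorems.GrenetZeon.SlowCore (linEntry Ledger RelCert
  lineSubst_apply_of_le_one freezeSpace linFun linFun_apply linEntry_eq_zero_of_mem_freezeSpace codim_freezeSpace_le
  pow_card_eq_zero_of_pow_eq_zero)
open Summit.ValiantsHypothesis.ValiantsHypothesis.Theorems.GrenetZeon.ResolventFlag (pointMat linMat)
open Summit.ValiantsHypothesis.ValiantsHypothesis.Theorems.GrenetZeon.RadicalSplit (lineSubst)

variable {n b : ℕ}

/-- Affine evaluation: `N(v) = N(0) + lin(v)`. [folklore] -/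
theorem pointMat_eq_pointMat_zero_add_linMat (B : AffMat n b) (hB : IsAffine B) (v : Fin n × Fin n → ℂ) :
    pointMat B v = pointMat B 0 + linMat B v := by
  refine Matrix.ext fun i j => ?_
  rw [Matrix.add_apply, pointMat, pointMat, Matrix.map_apply, Matrix.map_apply, linMat, Matrix.of_apply, linEntry]
  have hg := Literature.Computability.AlgebraicComplexity.LRPencil.eq_affine_of_totalDegree_le_one (B i j) (hB i j)
  have heval : ∀ y : Fin n × Fin n → ℂ,
      MvPolynomial.eval y (B i j) = coeff 0 (B i j) + ∑ w, coeff (Finsupp.single w 1) (B i j) * y w := by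
    intro y
    conv_lhs => rw [hg]
    simp [MvPolynomial.eval_X]
  rw [heval v, heval 0]
  simp only [Pi.zero_apply, mul_zero, Finset.sum_const_zero, add_zero, add_right_inj]
  exact Finset.sum_congr rfl fun c _ => mul_comm _ _

/-- The linear part `v ↦ lin(v)` as a linear map into `M_b(ℂ)`. -/
def linMap (B : AffMat n b) : (Fin n × Fin n → ℂ) →ₗ[ℂ] Matrix (Fin b) (Fin b) ℂ :=
  (Matrix.ofLinearEquiv ℂ).toLinearMap ∘ₗ LinearMap.pi fun i => LinearMap.pi fun j => linFun B i j

theorem linMap_apply (B : AffMat n b) (v : Fin n × Fin n → ℂ) : linMap B v = linMat B v := by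
  refine Matrix.ext fun i j => ?_
  simp [linMap, linMat, linFun_apply]

/-- The number of `π`-gap pairs `0 < π i' - π i ≤ q` is at most `b·q`. -/
theorem card_smallGap_le (π : Equiv.Perm (Fin b)) (q : ℕ) :
    ((Finset.univ : Finset (Fin b × Fin b)).filter
      (fun p => π p.1 < π p.2 ∧ (π p.2 : ℕ) ≤ (π p.1 : ℕ) + q)).card ≤ b * q := by
  classical
  set R := (Finset.univ : Finset (Fin b × Fin b)).filter
    (fun p => π p.1 < π p.2 ∧ (π p.2 : ℕ) ≤ (π p.1 : ℕ) + q) with hR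
  let f : Fin b × Fin b → Fin b × ℕ := fun p => (p.1, (π p.2 : ℕ) - (π p.1 : ℕ) - 1)
  have hinj : Set.InjOn f R := by
    intro p hp p' hp' hff
    rw [hR, Finset.coe_filter] at hp hp'
    simp only [Set.mem_setOf_eq, Finset.mem_univ, true_and] at hp hp'
    simp only [f, Prod.mk.injEq] at hff
    obtain ⟨h1, h2⟩ := hff
    have hlt : (π p.1 : ℕ) < π p.2 := Fin.lt_def.1 hp.1
    have hlt' : (π p'.1 : ℕ) < π p'.2 := Fin.lt_def.1 hp'.1
    rw [h1] at hlt h2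
    have h3 : (π p.2 : ℕ) = π p'.2 := by omega
    exact Prod.ext h1 (π.injective (Fin.ext h3))
  have hmaps : ∀ p ∈ R, f p ∈ (Finset.univ : Finset (Fin b)) ×ˢ Finset.range q := by
    intro p hp
    rw [hR, Finset.mem_filter] at hp
    simp only [f, Finset.mem_product, Finset.mem_univ, true_and, Finset.mem_range]
    have hlt : (π p.1 : ℕ) < π p.2 := Fin.lt_def.1 hp.2.1
    have hle := hp.2.2
    omega
  calc R.card ≤ ((Finset.univ : Finset (Fin b)) ×ˢ Finset.range q).card :=
        Finset.card_le_card_of_injOn f (fun p hp => hmaps p hp) hinj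
    _ = b * q := by rw [Finset.card_product, Finset.card_univ, Fintype.card_fin, Finset.card_range]

/-- ✓ **(G7b) THE RANK ROW HOLDS** — see `RankRow` in `Cruxes/DualUnipotentThreeHalves/RankRow.lean` (statement copied verbatim). -/
theorem rankRow_holds' : ∀ (n b : ℕ) (B : AffMat n b), IsAffine B → ∀ (π : Equiv.Perm (Fin b))
    (T₀ S : Submodule ℂ (Matrix (Fin b) (Fin b) ℂ)) (σ r : ℕ),
    (∀ A ∈ T₀, ∀ i j : Fin b, π j ≤ π i → A i j = 0) → Module.finrank ℂ S ≤ σ → (∀ A ∈ S, A.rank ≤ r) →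
    (∀ A ∈ T₀ ⊔ S, IsNilpotent A) → (∀ x : Fin n × Fin n → ℂ, B.map (MvPolynomial.eval x) ∈ T₀ ⊔ S) →
    ∀ q : ℕ, RelCert n b B (σ + b * q + n * ((r + 2) * ((b - 1) / (q + 1)))) := by
  intro n b B hB π T₀ S σ r hT₀ hσ hr hnil hval q
  classical
  -- the direction space `K = K₁ ⊓ K₂`
  set Rq : Finset (Fin b × Fin b) := (Finset.univ : Finset (Fin b × Fin b)).filter
    (fun p => π p.1 < π p.2 ∧ (π p.2 : ℕ) ≤ (π p.1 : ℕ) + q) with hRq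
  set K₁ : Submodule ℂ (Fin n × Fin n → ℂ) := T₀.comap (linMap B) with hK₁
  set K₂ : Submodule ℂ (Fin n × Fin n → ℂ) := freezeSpace B Rq with hK₂
  have hdom : Module.finrank ℂ (Fin n × Fin n → ℂ) = n * n := by
    rw [Module.finrank_pi, Fintype.card_prod, Fintype.card_fin]
  -- `lin v ∈ T₀ ⊔ S`
  have hlin_mem : ∀ v, linMap B v ∈ T₀ ⊔ S := by
    intro v
    have h := sub_mem (hval v) (hval 0)
    have h' : B.map (MvPolynomial.eval v) - B.map (MvPolynomial.eval 0) = linMat B v := by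
      change pointMat B v - pointMat B 0 = linMat B v
      rw [pointMat_eq_pointMat_zero_add_linMat B hB v, add_sub_cancel_left]
    rw [h'] at h
    rw [linMap_apply]; exact h
  -- `codim K₁ ≤ σ`
  have hK₁codim : n * n - Module.finrank ℂ K₁ ≤ σ := by
    have hrn := LinearMap.finrank_range_add_finrank_ker (T₀.mkQ ∘ₗ linMap B)
    have hker : LinearMap.ker (T₀.mkQ ∘ₗ linMap B) = K₁ := by rw [LinearMap.ker_comp, Submodule.ker_mkQ]
    have hrange : LinearMap.range (T₀.mkQ ∘ₗ linMap B) ≤ S.map T₀.mkQ := by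
      rintro _ ⟨v, rfl⟩
      obtain ⟨y, hy, z, hz, hyz⟩ := Submodule.mem_sup.1 (hlin_mem v)
      refine Submodule.mem_map.2 ⟨z, hz, ?_⟩
      rw [LinearMap.comp_apply, ← hyz, map_add]
      simp only [Submodule.mkQ_apply, (Submodule.Quotient.mk_eq_zero T₀).2 hy, zero_add]
    have h1 : Module.finrank ℂ (LinearMap.range (T₀.mkQ ∘ₗ linMap B)) ≤ σ :=
      (Submodule.finrank_mono hrange).trans ((Submodule.finrank_map_le _ _).trans hσ)
    rw [hker, hdom] at hrn
    omega
  have hK₂codim : n * n - Module.finrank ℂ K₂ ≤ b * q :=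
    (codim_freezeSpace_le B Rq).trans (card_smallGap_le π q)
  have hKcodim : n * n - Module.finrank ℂ (K₁ ⊓ K₂ : Submodule ℂ (Fin n × Fin n → ℂ)) ≤ σ + b * q := by
    have h := Submodule.finrank_sup_add_finrank_inf_eq K₁ K₂
    have hsup : Module.finrank ℂ ↥(K₁ ⊔ K₂) ≤ n * n := by rw [← hdom]; exact Submodule.finrank_le _
    omega
  refine ⟨K₁ ⊓ K₂, (r + 2) * ((b - 1) / (q + 1)), ?_, by omega⟩
  -- the ledger along `x + s v`, `v ∈ K`
  intro x v hv p _ i j _ _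
  obtain ⟨hv₁, hv₂⟩ := Submodule.mem_inf.1 hv
  have hLT : linMat B v ∈ T₀ := by
    rw [hK₁, Submodule.mem_comap, linMap_apply] at hv₁; exact hv₁
  obtain ⟨A₀, hA₀, S₀, hS₀, hAS⟩ := Submodule.mem_sup.1 (hval x)
  have hM : B.map (lineSubst x v) = pencilS (A₀ + S₀) (linMat B v) := by
    refine Matrix.ext fun i j => ?_
    have hx : MvPolynomial.eval x (B i j) = (A₀ + S₀) i j := by rw [hAS]; rfl
    rw [Matrix.map_apply, lineSubst_apply_of_le_one B hB x v i j, hx]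
    simp only [pencilS, Matrix.add_apply, Matrix.map_apply, Matrix.smul_apply, smul_eq_mul, linMat, Matrix.of_apply,
      map_add]
    ring
  rw [hM]
  refine totalDegree_pow_le_core π q r A₀ (linMat B v) S₀ (hT₀ A₀ hA₀) ?_ ?_ (hr S₀ hS₀) p i j
  · intro i i' hle
    by_cases hcase : π i' ≤ π i
    · exact hT₀ _ hLT i i' hcase
    · have hmem : (i, i') ∈ Rq := by
        rw [hRq, Finset.mem_filter]; exact ⟨Finset.mem_univ _, not_le.1 hcase, hle⟩
      rw [linMat, Matrix.of_apply]
      rw [hK₂] at hv₂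
      exact linEntry_eq_zero_of_mem_freezeSpace B Rq hmem hv₂
  · intro s t
    have hmem : A₀ + s • linMat B v + t • S₀ ∈ T₀ ⊔ S :=
      Submodule.add_mem_sup (T₀.add_mem hA₀ (T₀.smul_mem s hLT)) (S.smul_mem t hS₀)
    obtain ⟨k, hk⟩ := hnil _ hmem
    exact pow_card_eq_zero_of_pow_eq_zero _ hk

end Assembly


/-- ✓ **(G7b) THE RANK ROW HOLDS** (kernel; axioms `propext`, `Classical.choice`, `Quot.sound`). -/
theorem rankRow_holds : RankRow := rankRow_holds'

/-! ### §F′ The general constant flag: `theorem rankRowConst_holds : RankRowConst` (conjugate, apply `rankRow_holds` with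
`π = 1`, return by ✓ `SlowCore.ledger_top_of_conj`) -/

section ConstFlag

open Summit.ValiantsHypothesis.ValiantsHypothesis.Theorems.GrenetZeon.SlowCore (isAffine_conj ledger_top_of_conj)

variable {n b : ℕ}

/-- Conjugation `X ↦ P X Q` as a linear map. -/
def conjMap (P Q : Matrix (Fin b) (Fin b) ℂ) : Matrix (Fin b) (Fin b) ℂ →ₗ[ℂ] Matrix (Fin b) (Fin b) ℂ :=
  (LinearMap.mulLeft ℂ P).comp (LinearMap.mulRight ℂ Q)

theorem conjMap_apply (P Q X : Matrix (Fin b) (Fin b) ℂ) : conjMap P Q X = P * X * Q := by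
  simp [conjMap, Matrix.mul_assoc]

/-- Powers of a conjugate (`Q P = 1`). [folklore] -/
theorem conj_pow_succ (P Q X : Matrix (Fin b) (Fin b) ℂ) (hQP : Q * P = 1) (k : ℕ) :
    (P * X * Q) ^ (k + 1) = P * X ^ (k + 1) * Q := by
  induction k with
  | zero => rw [zero_add, pow_one, pow_one]
  | succ k ih =>
    rw [pow_succ, ih, pow_succ X (k + 1)]
    calc P * X ^ (k + 1) * Q * (P * X * Q) = P * X ^ (k + 1) * (Q * P) * X * Q := by simp only [Matrix.mul_assoc]
      _ = P * (X ^ (k + 1) * X) * Q := by rw [hQP, Matrix.mul_one]; simp only [Matrix.mul_assoc]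

/-- Values of a constant conjugate of a pencil (= ✓ `SlowCore.conj_map_eval`, re-proved to keep the imports minimal). -/
theorem map_eval_conj (B : AffMat n b) (P Q : Matrix (Fin b) (Fin b) ℂ) (x : Fin n × Fin n → ℂ) :
    (P.map C * B * Q.map C).map (MvPolynomial.eval x) = P * B.map (MvPolynomial.eval x) * Q := by
  rw [show ∀ A : AffMat n b, A.map (MvPolynomial.eval x) = (MvPolynomial.eval x).mapMatrix A from fun _ => rfl,
    map_mul, map_mul]
  simp only [RingHom.mapMatrix_apply]
  congr 1
  · congr 1
    ext i j; simp only [Matrix.map_apply, MvPolynomial.eval_C]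
  · ext i j; simp only [Matrix.map_apply, MvPolynomial.eval_C]

/-- ✓ **The rank row for a general constant flag** (`RankRowConst`). -/
theorem rankRowConst_holds : RankRowConst := by
  intro n b B hB P T₀ S σ r hT₀ hσ hr hnil hval q
  classical
  set Pm : Matrix (Fin b) (Fin b) ℂ := (P : Matrix (Fin b) (Fin b) ℂ) with hPm
  set Pi : Matrix (Fin b) (Fin b) ℂ := (↑P⁻¹ : Matrix (Fin b) (Fin b) ℂ) with hPi
  have hPiP : Pi * Pm = 1 := by rw [hPi, hPm]; exact Units.inv_mul P
  set B' : AffMat n b := Pm.map C * B * Pi.map C with hB'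
  set f : Matrix (Fin b) (Fin b) ℂ →ₗ[ℂ] Matrix (Fin b) (Fin b) ℂ := conjMap Pm Pi with hf
  have hB'aff : IsAffine B' := isAffine_conj B hB Pm Pi
  have hT₀' : ∀ A ∈ T₀.map f, ∀ i j : Fin b, (Equiv.refl (Fin b)) j ≤ (Equiv.refl (Fin b)) i → A i j = 0 := by
    intro A hA i j hij
    obtain ⟨X, hX, rfl⟩ := Submodule.mem_map.1 hA
    rw [hf, conjMap_apply]
    exact hT₀ X hX i j hij
  have hσ' : Module.finrank ℂ (S.map f) ≤ σ := (Submodule.finrank_map_le f S).trans hσ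
  have hr' : ∀ A ∈ S.map f, A.rank ≤ r := by
    intro A hA
    obtain ⟨X, hX, rfl⟩ := Submodule.mem_map.1 hA
    rw [hf, conjMap_apply]
    exact (Matrix.rank_mul_le_left _ _).trans ((Matrix.rank_mul_le_right _ _).trans (hr X hX))
  have hsup : T₀.map f ⊔ S.map f = (T₀ ⊔ S).map f := (Submodule.map_sup T₀ S f).symm
  have hnil' : ∀ A ∈ T₀.map f ⊔ S.map f, IsNilpotent A := by
    intro A hA
    rw [hsup] at hA
    obtain ⟨X, hX, rfl⟩ := Submodule.mem_map.1 hA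
    obtain ⟨k, hk⟩ := hnil X hX
    refine ⟨k + 1, ?_⟩
    rw [hf, conjMap_apply, conj_pow_succ Pm Pi X hPiP k, pow_succ, hk, Matrix.zero_mul, Matrix.mul_zero,
      Matrix.zero_mul]
  have hval' : ∀ x : Fin n × Fin n → ℂ, B'.map (MvPolynomial.eval x) ∈ T₀.map f ⊔ S.map f := by
    intro x
    rw [hsup, hB', map_eval_conj]
    refine Submodule.mem_map.2 ⟨B.map (MvPolynomial.eval x), hval x, ?_⟩
    rw [hf, conjMap_apply]
  obtain ⟨K, k, hL, hp⟩ :=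
    rankRow_holds n b B' hB'aff (Equiv.refl (Fin b)) (T₀.map f) (S.map f) σ r hT₀' hσ' hr' hnil' hval' q
  exact ⟨K, k, ledger_top_of_conj B B' Pm Pi hPiP rfl hL, hp⟩

end ConstFlag

end

end Summit.ValiantsHypothesis.ValiantsHypothesis.Cruxes.DualUnipotentThreeHalves.RankRow
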